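import Literature.AlgebraicGeometry.Motives.CechCoverDescent
import HarnessLib

/-!
# Noetherian descent of a Čech cover of `𝒪(D)` on `X ×_K T`, II: the descended divisor `D₀` and
# cover `𝔚₀` on a stage, and `Γ(V, 𝒪_T) ⊗_{K[t]} Γ(W₀_s, 𝒪(D₀)) ≅ Γ(W_s, 𝒪(D))`
# (Görtz–Wedhorn II, Thm. 23.133, proof, Step (IV); Prop. 22.90, proof)

Sequel of `Motives/CechCoverDescent`. There, for `X → Spec K` proper, `T` a `K`-scheme with
`X ×_K T` integral, `D` a Cartier divisor on `X ×_K T`, an affine open `V ⊆ T` with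
`B = Γ(V, 𝒪_V)` and a Čech cover `𝔚 = (W_a)` of `pr_T⁻¹V` adapted to `D`, the cover and the
local equations `f_{c(a)}` of `D` were descended along
`(X ⊗ Spec B).left = lim_t (X ⊗ Spec K[t]).left` to a finite stage
(`CartierDivisor.CechCover.exists_stageData`). This file turns the descended data into the
objects of `Literature/Algebra/Homology/OrderedCechExtendScalars` and proves its hypotheses, i.e.
the identification "`Č•((U_i)_i, 𝓕) ⊗_A A' ≅ Č•((u'⁻¹(U_i))_i, 𝓕')`" of Görtz–Wedhorn II, proof
of Prop. 22.90 (p. 388) for `𝓕 = 𝒪(D₀)`, `A = K[t]`, `A' = B`: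

* `stage`, `stageBase` (`Spec K[t]`), `stageLeg` (`π_t`), `stageW`, `stageψ` — the chosen stage
  data; `stageDivisor` — **the descended Cartier divisor `D₀ = (W₀_a, ψ_a)_a`** on
  `(X ⊗ Spec K[t]).left` ("`𝓕_λ` [...] whose pullback to `X` is `𝓕`", Thm. 23.133, Step (IV));
  `stageCover` — **the descended Čech cover `𝔚₀ = (W₀_a)_a` over the whole affine `Spec K[t]`**,
  with the index set of `𝔚` (`stageCover_r`), `π_t⁻¹(W₀_s) = toProd⁻¹(W_s)`
  (`preimage_stageCover_opens`);
* `stageRingHom` — the ring homomorphism `f : Γ(Spec K[t], 𝒪) → Γ(V, 𝒪_T)` (`K[t] ⊆ B ≅ Γ(V, 𝒪_T)`,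
  through the restriction isomorphism `resSpec : Γ(V, 𝒪_T) ≅ Γ(Spec B, 𝒪)`);
* `stageΘ`, `stageΘₛₗ` — **the pullback of rational functions**
  `Θ = (toProd^♯)⁻¹ ∘ π_t^♯ : K((X ⊗ Spec K[t]).left) → K(X ×_K T)` (`toProdFieldEquiv`: an open
  immersion of integral schemes identifies function fields), `f`-semilinear for the module
  structures of `Motives/CartierDivisorCech` (`stageΘ_ofSection_app`: `Θ ∘ pr₀^* = pr_T^* ∘ f`),
  with `Θ(ψ_a) = f_{c(a)}` (`stageΘ_stageψ`) and `Θ(Γ(W₀_s, 𝒪(D₀))) ⊆ Γ(W_s, 𝒪(D))`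
  (`stageΘ_mem_sectionsOn`: regularity ascends along `π_t`, descends along the flat `toProd`);
* `baseChangeMap_bijective` — **`Γ(V, 𝒪_T) ⊗_{K[t]} Γ(W₀_s, 𝒪(D₀)) → Γ(W_s, 𝒪(D))`,
  `c ⊗ x ↦ c Θ(x)`, is bijective** for `s ≠ ∅`: through the trivialisations by `ψ_a⁻¹` and
  `f_{c(a)}⁻¹` (`a ∈ s`) and `Γ(V, 𝒪_T) ≅ Γ(Spec B, 𝒪)` it is the canonical map
  `Γ(Spec B, 𝒪) ⊗_{Γ(Spec K[t], 𝒪)} Γ(W₀_s, 𝒪) → Γ(π_t⁻¹W₀_s, 𝒪)`, bijective since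
  `π_t⁻¹W₀_s = W₀_s ×_{Spec K[t]} Spec B` with all three affine (Mathlib
  `isIso_pushoutSection_of_isAffineOpen`, `CommRingCat.isPushout_iff_isPushout`,
  `Algebra.IsPushout.equiv`: "`𝓕(V) ⊗_A A' = 𝓕(u'⁻¹(V), 𝓕')` for every open affine subscheme
  `V ⊆ X`", loc. cit.).

The hypotheses `[IsIntegral (X ⊗ Spec B).left]`, `[IsDomain B]`,
`[∀ t, IsIntegral (X ⊗ Spec K[t]).left]` of this file are theorems of `Motives/CechCoverDescent`
(`isIntegral_prodCone_pt`, `isDomain_sections`, `isIntegral_prodDiagram_obj_of_isIntegral`); they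
are carried as instance hypotheses so that the divisor on the stage can be typed, and discharged
in the sequel (the reduction of `cechComplex_pseudoCoherent_general` to a base of finite type).
Everything is proved; no named facts. Mathlib searched and used (pin): `Scheme.Hom.congr_app`,
`Scheme.Hom.comp_app`, `Scheme.Hom.naturality`, `Scheme.Hom.appLE_comp_appLE`,
`Scheme.Hom.app_eq_appLE`, `Scheme.Hom.isIso_app`, `isIso_pushoutSection_of_isAffineOpen`,
`isIso_pushoutSection_iff`, `CommRingCat.isPushout_iff_isPushout`, `Algebra.IsPushout.equiv`,
`Algebra.IsPushout.equiv_tmul`, `Algebra.IsPushout.symm`, `TensorProduct.congr`,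
`TensorProduct.induction_on`, `Scheme.germ_injective_of_isIntegral`,
`TopCat.Presheaf.stalkSpecializes_comp` (function fields along an open immersion); in this tree:
`CartierDivisor.sectionsOnEquiv` / `trivialisation_surjective`, `CechCover.isAffineOpen_opens` /
`flat_sectionsOn`, `RatFn.IsRegularAt.of_functionFieldMap` (`Motives/RatFnFlatDescent`),
`SubalgApprox.appLE_congrHom`, `OrderedCech.baseChangeMap` / `coe_baseChangeMap_tmul`.
Elaboration notes: equalities between rational functions of sections pulled back along the
(pullback-)morphisms `toProd`, `π_t` are composed as explicit equalities rather than rewritten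
(definitional unfolding of these morphisms is prohibitively expensive), and the identifications
of `baseChangeMap_bijective` are used through their formulas only (`clear_value`).

## References

* U. Görtz, T. Wedhorn, *Algebraic Geometry II: Cohomology of Schemes*, Springer Spektrum (2023),
  doi:10.1007/978-3-658-43031-3: Prop. 22.90 and its proof, pp. 387–388; Thm. 23.133, proof,
  Step (IV), p. 479 (read via the held copy). [GortzWedhorn2023]
* U. Görtz, T. Wedhorn, *Algebraic Geometry I: Schemes*, 2nd ed. (2020): (10.13), pp. 321–322;
  Thm. 10.60, p. 326. [GortzWedhorn2020]
-/

universe u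

open CategoryTheory CategoryTheory.Limits AlgebraicGeometry TopologicalSpace Opposite
open MonoidalCategory CartesianMonoidalCategory TensorProduct
open Literature.AlgebraicGeometry.Limits Literature.AlgebraicGeometry.Limits.SubalgApprox
open Literature.AlgebraicGeometry.Motives.RatFn

noncomputable section

namespace Literature.AlgebraicGeometry.Motives

set_option backward.isDefEq.respectTransparency false

/-! ### The two syntactic forms of the cone point and of the stages -/

section Forms

variable {K : Type u} [Field K] (X T : SchemeOver K) (V : T.left.Opens)

/-- The cone point `(prodCone K B ∅ X).pt` is `(X ⊗ Spec B).left` (by `rfl`); this transports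
integrality between the two spellings for instance search. [folklore] -/
instance isIntegral_prodCone_pt_of [h : IsIntegral (X ⊗ specOver K Γ(↑V, ⊤)).left] :
    IsIntegral (prodCone K Γ(↑V, ⊤) (∅ : Finset Γ(↑V, ⊤)) X).pt := h

/-- The stages `(prodDiagram K B ∅ X).obj t` are the `(X ⊗ Spec K[t]).left` (by `rfl`); this
transports integrality between the two spellings for instance search. [folklore] -/
instance isIntegral_tensorObj_baseDiagram_obj
    [h : ∀ t, IsIntegral ((prodDiagram K Γ(↑V, ⊤) (∅ : Finset Γ(↑V, ⊤)) X).obj t)]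
    (t : (Idx Γ(↑V, ⊤) (∅ : Finset Γ(↑V, ⊤)))ᵒᵖ) :
    IsIntegral (X ⊗ (baseDiagram K Γ(↑V, ⊤) (∅ : Finset Γ(↑V, ⊤))).obj t).left := h t

end Forms

/-! ### The descended divisor `D₀` and Čech cover `𝔚₀` on the stage -/

namespace CartierDivisor.CechCover

variable {K : Type u} [Field K] {X T : SchemeOver K} [IsIntegral (X ⊗ T).left]
  {D : CartierDivisor (X ⊗ T).left} {V : T.left.Opens} (hV : IsAffineOpen V)
  (𝔚 : CartierDivisor.CechCover (snd X T).left V D)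
  [IsIntegral (X ⊗ specOver K Γ(↑V, ⊤)).left] [IsDomain Γ(↑V, ⊤)]
  [∀ t, IsIntegral ((prodDiagram K Γ(↑V, ⊤) (∅ : Finset Γ(↑V, ⊤)) X).obj t)] [IsProper X.hom]

/-- **The stage** `t` of the limit presentation `(X ⊗ Spec B).left = lim_t (X ⊗ Spec K[t]).left`
to which the Čech cover `𝔚` and the local equations of `D` descend (`exists_stageData`).
[folklore] -/
def stage : (Idx Γ(↑V, ⊤) (∅ : Finset Γ(↑V, ⊤)))ᵒᵖ := (𝔚.exists_stageData hV).choose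

/-- The `K`-scheme `Spec K[t]` of the stage (an `abbrev`, so that the instances of
`Limits/SubalgebraDiagram` about the stages apply). [folklore] -/
abbrev stageBase : SchemeOver K := (baseDiagram K Γ(↑V, ⊤) (∅ : Finset Γ(↑V, ⊤))).obj (𝔚.stage hV)

/-- `(X ⊗ Spec K[t]).left` is integral (instance form for the stage). [folklore] -/
instance isIntegral_tensorObj_stageBase_left : IsIntegral (X ⊗ 𝔚.stageBase hV).left :=
  isIntegral_tensorObj_baseDiagram_obj X T V _

/-- The leg `(X ⊗ Spec B).left → (X ⊗ Spec K[t]).left` of the limit cone at the stage.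
[folklore] -/
def stageLeg : (X ⊗ specOver K Γ(↑V, ⊤)).left ⟶ (X ⊗ 𝔚.stageBase hV).left :=
  leg Γ(↑V, ⊤) ∅ X (𝔚.stage hV)

/-- The leg is dominant. [folklore] -/
instance isDominant_stageLeg : IsDominant (𝔚.stageLeg hV) :=
  inferInstanceAs (IsDominant (leg Γ(↑V, ⊤) ∅ X (𝔚.stage hV)))

/-- The descended opens `W₀_a` of `(X ⊗ Spec K[t]).left`. [folklore] -/
def stageW : Fin (𝔚.r + 1) → (X ⊗ 𝔚.stageBase hV).left.Opens :=
  (𝔚.exists_stageData hV).choose_spec.choose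

/-- The descended local equations `ψ_a ∈ K((X ⊗ Spec K[t]).left)`. [folklore] -/
def stageψ : Fin (𝔚.r + 1) → (X ⊗ 𝔚.stageBase hV).left.functionField :=
  (𝔚.exists_stageData hV).choose_spec.choose_spec.choose

/-- The defining properties of the stage data. [folklore] -/
theorem stage_spec :
    (⨆ a, 𝔚.stageW hV a) = ⊤ ∧ (∀ a, IsAffineOpen (𝔚.stageW hV a)) ∧
      (∀ a, 𝔚.stageLeg hV ⁻¹ᵁ 𝔚.stageW hV a = toProd X T V hV ⁻¹ᵁ 𝔚.W a) ∧
      (∀ a, functionFieldMap (𝔚.stageLeg hV) (𝔚.stageψ hV a) =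
        functionFieldMap (toProd X T V hV) (D.f (𝔚.chart a))) ∧
      (∀ a b (w : ↥(X ⊗ 𝔚.stageBase hV).left),
        w ∈ 𝔚.stageW hV a → w ∈ 𝔚.stageW hV b → IsUnitAt w (𝔚.stageψ hV a / 𝔚.stageψ hV b)) :=
  (𝔚.exists_stageData hV).choose_spec.choose_spec.choose_spec

/-- The `W₀_a` cover the stage. [folklore] -/
theorem iSup_stageW : (⨆ a, 𝔚.stageW hV a) = ⊤ := (𝔚.stage_spec hV).1

/-- The `W₀_a` are affine. [folklore] -/
theorem isAffineOpen_stageW (a : Fin (𝔚.r + 1)) : IsAffineOpen (𝔚.stageW hV a) :=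
  (𝔚.stage_spec hV).2.1 a

/-- **`π_t⁻¹(W₀_a) = toProd⁻¹(W_a)`.** [folklore] -/
theorem preimage_stageW (a : Fin (𝔚.r + 1)) :
    𝔚.stageLeg hV ⁻¹ᵁ 𝔚.stageW hV a = toProd X T V hV ⁻¹ᵁ 𝔚.W a :=
  (𝔚.stage_spec hV).2.2.1 a

/-- **`π_t^♯ ψ_a = toProd^♯ f_{c(a)}`.** [folklore] -/
theorem functionFieldMap_stageψ (a : Fin (𝔚.r + 1)) :
    functionFieldMap (𝔚.stageLeg hV) (𝔚.stageψ hV a) =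
      functionFieldMap (toProd X T V hV) (D.f (𝔚.chart a)) :=
  (𝔚.stage_spec hV).2.2.2.1 a

/-- `ψ_a / ψ_b` is a unit on `W₀_a ∩ W₀_b`. [folklore] -/
theorem isUnitAt_stageψ_div (a b : Fin (𝔚.r + 1)) (w : ↥(X ⊗ 𝔚.stageBase hV).left)
    (ha : w ∈ 𝔚.stageW hV a) (hb : w ∈ 𝔚.stageW hV b) :
    IsUnitAt w (𝔚.stageψ hV a / 𝔚.stageψ hV b) :=
  (𝔚.stage_spec hV).2.2.2.2 a b w ha hb

/-- The `ψ_a` are non-zero (their pullbacks are the non-zero `toProd^♯ f_{c(a)}`). [folklore] -/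
theorem stageψ_ne_zero (a : Fin (𝔚.r + 1)) : 𝔚.stageψ hV a ≠ 0 := fun h => by
  have h1 := 𝔚.functionFieldMap_stageψ hV a
  rw [h, map_zero] at h1
  exact (map_ne_zero (functionFieldMap (toProd X T V hV))).2 (D.f_ne_zero (𝔚.chart a)) h1.symm

/-- The generic point of the stage lies in every `W₀_a`. [folklore] -/
theorem genericPoint_mem_stageW (a : Fin (𝔚.r + 1)) :
    genericPoint (X ⊗ 𝔚.stageBase hV).left ∈ 𝔚.stageW hV a := by
  have h : genericPoint (X ⊗ specOver K Γ(↑V, ⊤)).left ∈ 𝔚.stageLeg hV ⁻¹ᵁ 𝔚.stageW hV a := by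
    rw [𝔚.preimage_stageW hV]
    exact 𝔚.genericPoint_mem_preimage_W hV a
  have h' := (Scheme.Hom.mem_preimage _).1 h
  rwa [genericPoint_eq_of_isDominant] at h'

/-- Every point of the stage lies in some `W₀_a`. [folklore] -/
theorem exists_mem_stageW (w : ↥(X ⊗ 𝔚.stageBase hV).left) : ∃ a, w ∈ 𝔚.stageW hV a := by
  have hw : w ∈ (⨆ a, 𝔚.stageW hV a) := by rw [𝔚.iSup_stageW hV]; trivial
  exact Opens.mem_iSup.1 hw

/-- **The descended Cartier divisor `D₀ = (W₀_a, ψ_a)_a` on `(X ⊗ Spec K[t]).left`**, whose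
pullback along the leg has the same local equations as `D|_{pr_T⁻¹V}` on the cover `𝔚`
(Görtz–Wedhorn II, Thm. 23.133, Step (IV): "`𝓕_λ` [...] whose pullback to `X` is `𝓕`";
Görtz–Wedhorn I, Thm. 10.60 / Exercise 10.33 for line bundles). [cite: GortzWedhorn2023, Thm. 23.133, proof, Step (IV) (p. 479)] -/
def stageDivisor : CartierDivisor (X ⊗ 𝔚.stageBase hV).left where
  ι := ULift.{u} (Fin (𝔚.r + 1))
  U := fun i => 𝔚.stageW hV i.down
  covers := fun w => by
    obtain ⟨a, ha⟩ := 𝔚.exists_mem_stageW hV w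
    exact ⟨⟨a⟩, ha⟩
  f := fun i => 𝔚.stageψ hV i.down
  f_ne_zero := fun i => 𝔚.stageψ_ne_zero hV i.down
  isUnitAt_div := fun i j => 𝔚.isUnitAt_stageψ_div hV i.down j.down

/-- The charts of `D₀` are the `W₀_a` (by `rfl`; the index type is `Fin (r + 1)` lifted to the
universe of schemes). [folklore] -/
@[simp] theorem stageDivisor_U (i : ULift.{u} (Fin (𝔚.r + 1))) :
    (𝔚.stageDivisor hV).U i = 𝔚.stageW hV i.down := rfl

/-- The local equations of `D₀` are the `ψ_a` (by `rfl`). [folklore] -/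
@[simp] theorem stageDivisor_f (i : ULift.{u} (Fin (𝔚.r + 1))) :
    (𝔚.stageDivisor hV).f i = 𝔚.stageψ hV i.down := rfl

/-- **The descended Čech cover `𝔚₀ = (W₀_a)_a` of `(X ⊗ Spec K[t]).left` over the whole
(affine) stage base, adapted to `D₀`**, with the same index set as `𝔚`. [folklore] -/
def stageCover : CartierDivisor.CechCover (snd X (𝔚.stageBase hV)).left ⊤ (𝔚.stageDivisor hV) where
  r := 𝔚.r
  W := 𝔚.stageW hV
  W_le := fun a => by rw [Opens.map_top]; exact le_top
  isAffineOpen_W := 𝔚.isAffineOpen_stageW hV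
  genericPoint_mem_W := 𝔚.genericPoint_mem_stageW hV
  chart := ULift.up
  W_le_U := fun _ => le_rfl
  iSup_W := by rw [Opens.map_top]; exact 𝔚.iSup_stageW hV

/-- The members of `𝔚₀` are the `W₀_a` (by `rfl`). [folklore] -/
@[simp] theorem stageCover_W (a : Fin (𝔚.r + 1)) : (𝔚.stageCover hV).W a = 𝔚.stageW hV a := rfl

/-- `𝔚₀` has the index set of `𝔚` (by `rfl`). [folklore] -/
theorem stageCover_r : (𝔚.stageCover hV).r = 𝔚.r := rfl

/-- **`π_t⁻¹(W₀_s) = toProd⁻¹(W_s)` for all finite sets of indices `s`** (membership is tested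
pointwise through `mem_opens_iff`). [folklore] -/
theorem preimage_stageCover_opens (s : Finset (Fin (𝔚.r + 1))) :
    𝔚.stageLeg hV ⁻¹ᵁ (𝔚.stageCover hV).opens s = toProd X T V hV ⁻¹ᵁ 𝔚.opens s := by
  ext w
  change w ∈ 𝔚.stageLeg hV ⁻¹ᵁ (𝔚.stageCover hV).opens s ↔ w ∈ toProd X T V hV ⁻¹ᵁ 𝔚.opens s
  rw [Scheme.Hom.mem_preimage, Scheme.Hom.mem_preimage, CechCover.mem_opens_iff,
    CechCover.mem_opens_iff]
  constructor
  · rintro ⟨-, h⟩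
    refine ⟨?_, fun a ha => ?_⟩
    · have hw : w ∈ toProd X T V hV ⁻¹ᵁ ((snd X T).left ⁻¹ᵁ V) := by
        rw [toProd_preimage_preimage_eq_top]; trivial
      exact (Scheme.Hom.mem_preimage _).1 hw
    · have hw : w ∈ 𝔚.stageLeg hV ⁻¹ᵁ 𝔚.stageW hV a := (Scheme.Hom.mem_preimage _).2 (h a ha)
      rw [𝔚.preimage_stageW hV] at hw
      exact (Scheme.Hom.mem_preimage _).1 hw
  · rintro ⟨-, h⟩
    refine ⟨?_, fun a ha => ?_⟩
    · rw [Opens.map_top]; trivial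
    · have hw : w ∈ toProd X T V hV ⁻¹ᵁ 𝔚.W a := (Scheme.Hom.mem_preimage _).2 (h a ha)
      rw [← 𝔚.preimage_stageW hV] at hw
      exact (Scheme.Hom.mem_preimage _).1 hw

/-! ### The ring homomorphism `K[t] = Γ(Spec K[t], 𝒪) → Γ(V, 𝒪_T)` of the stage -/

/-- The structure morphism `Spec B → Spec K[t]` of the stage (`K[t] ⊆ B`). [folklore] -/
def stageBaseHom : specOver K Γ(↑V, ⊤) ⟶ 𝔚.stageBase hV :=
  (baseCone K Γ(↑V, ⊤) (∅ : Finset Γ(↑V, ⊤))).π.app (𝔚.stage hV)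

/-- The leg is the base change `X × (Spec B → Spec K[t])` (by `rfl`). [folklore] -/
theorem stageLeg_eq : 𝔚.stageLeg hV = (X ◁ 𝔚.stageBaseHom hV).left := rfl

/-- `π_t` followed by the projection of the stage is the projection to `Spec B` followed by
`Spec B → Spec K[t]`. [folklore] -/
theorem stageLeg_comp_snd :
    𝔚.stageLeg hV ≫ (snd X (𝔚.stageBase hV)).left =
      (snd X (specOver K Γ(↑V, ⊤))).left ≫ (𝔚.stageBaseHom hV).left := by
  rw [stageLeg_eq, ← Over.comp_left, ← Over.comp_left, whiskerLeft_snd]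

omit [IsIntegral (X ⊗ T).left] [IsIntegral (X ⊗ specOver K Γ(↑V, ⊤)).left] [IsDomain Γ(↑V, ⊤)]
  [∀ t, IsIntegral ((prodDiagram K Γ(↑V, ⊤) (∅ : Finset Γ(↑V, ⊤)) X).obj t)] [IsProper X.hom] in
/-- `toProd` followed by `pr_T` is the projection to `Spec B` followed by `Spec B ≅ V → T`.
[folklore] -/
theorem toProd_comp_snd :
    toProd X T V hV ≫ (snd X T).left =
      (snd X (specOver K Γ(↑V, ⊤))).left ≫ (specToBase T V hV).left := by
  rw [toProd, ← Over.comp_left, ← Over.comp_left, whiskerLeft_snd]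

omit [IsIntegral (X ⊗ T).left] [IsIntegral (X ⊗ specOver K Γ(↑V, ⊤)).left] [IsDomain Γ(↑V, ⊤)]
  [∀ t, IsIntegral ((prodDiagram K Γ(↑V, ⊤) (∅ : Finset Γ(↑V, ⊤)) X).obj t)] [IsProper X.hom] in
/-- `(Spec B ≅ V → T)⁻¹(V)` is everything. [folklore] -/
theorem specToBase_preimage_eq_top : (specToBase T V hV).left ⁻¹ᵁ V = ⊤ := by
  rw [eq_top_iff]
  intro x _
  have hx : (specToBase T V hV).left x ∈ Set.range (specToBase T V hV).left := ⟨x, rfl⟩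
  rw [range_specToBase_left] at hx
  exact (Scheme.Hom.mem_preimage _).2 hx

/-- **Restriction `Γ(V, 𝒪_T) → Γ(Spec B, 𝒪)` along `Spec B ≅ V → T`** (an isomorphism).
[folklore] -/
def resSpec (T : SchemeOver K) (V : T.left.Opens) (hV : IsAffineOpen V) :
    Γ(T.left, V) ⟶ Γ((specOver K Γ(↑V, ⊤)).left, ⊤) :=
  (specToBase T V hV).left.appLE V ⊤ (specToBase_preimage_eq_top hV).ge

omit [IsIntegral (X ⊗ T).left] [IsIntegral (X ⊗ specOver K Γ(↑V, ⊤)).left] [IsDomain Γ(↑V, ⊤)]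
  [∀ t, IsIntegral ((prodDiagram K Γ(↑V, ⊤) (∅ : Finset Γ(↑V, ⊤)) X).obj t)] [IsProper X.hom] in
/-- `resSpec` is an isomorphism (`Spec B → T` is an open immersion onto `V`). [folklore] -/
instance isIso_resSpec : IsIso (resSpec T V hV) := by
  unfold resSpec Scheme.Hom.appLE
  haveI := (specToBase T V hV).left.isIso_app V (by
    intro x hx
    change x ∈ Set.range (specToBase T V hV).left
    rw [range_specToBase_left]; exact hx)
  haveI : IsIso ((specOver K Γ(↑V, ⊤)).left.presheaf.map
      (homOfLE (specToBase_preimage_eq_top hV).ge).op) := by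
    have e : homOfLE (specToBase_preimage_eq_top hV).ge =
        eqToHom (specToBase_preimage_eq_top hV).symm := Subsingleton.elim _ _
    rw [e, eqToHom_op]
    infer_instance
  infer_instance

/-- **The ring homomorphism `f : Γ(Spec K[t], 𝒪) → Γ(V, 𝒪_T)`** of the stage:
`K[t] ⊆ B = Γ(V, 𝒪_V) ≅ Γ(V, 𝒪_T)`, spelled as `(Spec B → Spec K[t])^*` followed by the inverse
of the restriction isomorphism `resSpec`. [folklore] -/
def stageRingHom : Γ((𝔚.stageBase hV).left, ⊤) →+* Γ(T.left, V) :=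
  ((𝔚.stageBaseHom hV).left.appTop ≫ inv (resSpec T V hV)).hom

/-- The defining property of `stageRingHom`: restricted to `Spec B` it is
`(Spec B → Spec K[t])^*`. [folklore] -/
theorem resSpec_stageRingHom (b : Γ((𝔚.stageBase hV).left, ⊤)) :
    resSpec T V hV (𝔚.stageRingHom hV b) = (𝔚.stageBaseHom hV).left.appTop b := by
  unfold stageRingHom
  rw [← CommRingCat.comp_apply, Category.assoc, IsIso.inv_hom_id, Category.comp_id]

/-! ### The pullback of rational functions `Θ : K((X ⊗ Spec K[t]).left) → K(X ×_K T)` -/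

omit [IsDomain Γ(↑V, ⊤)] [∀ t, IsIntegral ((prodDiagram K Γ(↑V, ⊤) (∅ : Finset Γ(↑V, ⊤)) X).obj t)]
  [IsProper X.hom] in
/-- `toProd^♯ : K(X ×_K T) → K((X ⊗ Spec B).left)` is surjective (an open immersion of integral
schemes induces an isomorphism of function fields; cf.
`RatFn.functionFieldMap_surjective_of_isOpenImmersion` of `Motives/TheoremOfCubeLimit`, not
imported here). [folklore] -/
theorem functionFieldMap_toProd_surjective :
    Function.Surjective (functionFieldMap (toProd X T V hV)) := by
  intro b
  set f := toProd X T V hV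
  have h : f (genericPoint _) ⤳ genericPoint (X ⊗ T).left := specializes_genericPoint f
  have h' : genericPoint (X ⊗ T).left ⤳ f (genericPoint _) :=
    (genericPoint_spec (X ⊗ T).left).specializes (Set.mem_univ _)
  refine ⟨(X ⊗ T).left.presheaf.stalkSpecializes h' (inv (f.stalkMap (genericPoint _)) b), ?_⟩
  simp only [functionFieldMap, CommRingCat.hom_comp, RingHom.coe_comp, Function.comp_apply]
  rw [← CommRingCat.comp_apply ((X ⊗ T).left.presheaf.stalkSpecializes h'),
    TopCat.Presheaf.stalkSpecializes_comp]
  erw [TopCat.Presheaf.stalkSpecializes_refl]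
  rw [CommRingCat.id_apply, ← CommRingCat.comp_apply, IsIso.inv_hom_id, CommRingCat.id_apply]

/-- **`K(X ×_K T) ≅ K((X ⊗ Spec B).left)`** along `toProd`. [folklore] -/
def toProdFieldEquiv (X T : SchemeOver K) (V : T.left.Opens) (hV : IsAffineOpen V)
    [IsIntegral (X ⊗ T).left] [IsIntegral (X ⊗ specOver K Γ(↑V, ⊤)).left] :
    (X ⊗ T).left.functionField ≃+* (X ⊗ specOver K Γ(↑V, ⊤)).left.functionField :=
  RingEquiv.ofBijective (functionFieldMap (toProd X T V hV))
    ⟨(functionFieldMap (toProd X T V hV)).injective, functionFieldMap_toProd_surjective hV⟩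

omit [IsDomain Γ(↑V, ⊤)] [∀ t, IsIntegral ((prodDiagram K Γ(↑V, ⊤) (∅ : Finset Γ(↑V, ⊤)) X).obj t)]
  [IsProper X.hom] in
/-- `toProdFieldEquiv` is `toProd^♯`. [folklore] -/
@[simp] theorem toProdFieldEquiv_apply (h : (X ⊗ T).left.functionField) :
    toProdFieldEquiv X T V hV h = functionFieldMap (toProd X T V hV) h := rfl

/-- **The pullback of rational functions from the stage to `X ×_K T`**:
`Θ = (toProd^♯)⁻¹ ∘ π_t^♯ : K((X ⊗ Spec K[t]).left) → K((X ⊗ Spec B).left) ≅ K(X ×_K T)`.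
[folklore] -/
def stageΘ : (X ⊗ 𝔚.stageBase hV).left.functionField →+* (X ⊗ T).left.functionField :=
  (toProdFieldEquiv X T V hV).symm.toRingHom.comp (functionFieldMap (𝔚.stageLeg hV))

/-- `toProd^♯ ∘ Θ = π_t^♯`. [folklore] -/
theorem functionFieldMap_toProd_stageΘ (x : (X ⊗ 𝔚.stageBase hV).left.functionField) :
    functionFieldMap (toProd X T V hV) (𝔚.stageΘ hV x) = functionFieldMap (𝔚.stageLeg hV) x := by
  unfold stageΘ
  rw [RingHom.comp_apply, ← toProdFieldEquiv_apply hV]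
  exact (toProdFieldEquiv X T V hV).apply_symm_apply _

/-- **`Θ(ψ_a) = f_{c(a)}`**: `Θ` maps the descended local equations back to the local equations
of `D`. [folklore] -/
theorem stageΘ_stageψ (a : Fin (𝔚.r + 1)) : 𝔚.stageΘ hV (𝔚.stageψ hV a) = D.f (𝔚.chart a) := by
  apply (functionFieldMap (toProd X T V hV)).injective
  rw [functionFieldMap_toProd_stageΘ, functionFieldMap_stageψ]

/-! ### `Θ` is semilinear over `f` -/

/-- **Compatibility of `Θ` with the base rings**: `Θ(pr₀^*(b)) = pr_T^*(f(b))` as rational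
functions, i.e. `Θ ∘ (K[t] → K((X ⊗ Spec K[t]).left)) = (Γ(V, 𝒪_T) → K(X ×_K T)) ∘ f` — both
sides pull back, to `(X ⊗ Spec B).left`, to the rational function of the global section
`pr_{Spec B}^*((Spec B → Spec K[t])^* b)`. [folklore] -/
theorem stageΘ_ofSection_app (b : Γ((𝔚.stageBase hV).left, ⊤)) :
    𝔚.stageΘ hV (ofSection (𝔚.stageCover hV).genericPoint_mem
        ((snd X (𝔚.stageBase hV)).left.app ⊤ b)) =
      ofSection 𝔚.genericPoint_mem ((snd X T).left.app V (𝔚.stageRingHom hV b)) := by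
  apply (functionFieldMap (toProd X T V hV)).injective
  rw [functionFieldMap_toProd_stageΘ, functionFieldMap_ofSection, functionFieldMap_ofSection]
  -- abbreviations
  set pr'' := (snd X (specOver K Γ(↑V, ⊤))).left with hpr''
  set sbh := (𝔚.stageBaseHom hV).left with hsbh
  set stb := (specToBase T V hV).left with hstb
  set x := 𝔚.stageRingHom hV b with hx
  have hξ'' : genericPoint (X ⊗ specOver K Γ(↑V, ⊤)).left ∈ (pr'' ⁻¹ᵁ ⊤ : (X ⊗ specOver K Γ(↑V, ⊤)).left.Opens) := by
    rw [Opens.map_top]; trivial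
  -- the left hand side is the pullback of `pr''^*(sbh^* b)`
  have hL : 𝔚.stageLeg hV ⁻¹ᵁ ((snd X (𝔚.stageBase hV)).left ⁻¹ᵁ ⊤) = pr'' ⁻¹ᵁ ⊤ := by
    rw [Opens.map_top, Opens.map_top, Opens.map_top]
  have eL : (𝔚.stageLeg hV).app ((snd X (𝔚.stageBase hV)).left ⁻¹ᵁ ⊤)
      ((snd X (𝔚.stageBase hV)).left.app ⊤ b) =
      (X ⊗ specOver K Γ(↑V, ⊤)).left.presheaf.map (eqToHom hL).op (pr''.app ⊤ (sbh.appTop b)) := by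
    have h := Scheme.Hom.congr_app (𝔚.stageLeg_comp_snd hV) ⊤
    have h' := congrArg (fun φ : Γ((𝔚.stageBase hV).left, ⊤) ⟶ _ => φ b) h
    simp only [Scheme.Hom.comp_app, CommRingCat.comp_apply] at h'
    exact h'
  -- the right hand side is the pullback of `pr''^*(stb^* x)`
  have hR : toProd X T V hV ⁻¹ᵁ ((snd X T).left ⁻¹ᵁ V) = pr'' ⁻¹ᵁ (stb ⁻¹ᵁ V) := by
    rw [← Scheme.Hom.comp_preimage, ← Scheme.Hom.comp_preimage, toProd_comp_snd (X := X) hV]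
  have eR : (toProd X T V hV).app ((snd X T).left ⁻¹ᵁ V) ((snd X T).left.app V x) =
      (X ⊗ specOver K Γ(↑V, ⊤)).left.presheaf.map (eqToHom hR).op
        (pr''.app (stb ⁻¹ᵁ V) (stb.app V x)) := by
    have h := Scheme.Hom.congr_app (toProd_comp_snd (X := X) hV) V
    have h' := congrArg (fun φ : Γ(T.left, V) ⟶ _ => φ x) h
    simp only [Scheme.Hom.comp_app, CommRingCat.comp_apply] at h'
    exact h'
  -- `stb^* x` restricts to `sbh^* b` on `Spec B`
  have eres : (specOver K Γ(↑V, ⊤)).left.presheaf.map (homOfLE (specToBase_preimage_eq_top hV).ge).op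
      (stb.app V x) = sbh.appTop b := by
    rw [← 𝔚.resSpec_stageRingHom hV b, resSpec, Scheme.Hom.appLE, CommRingCat.comp_apply]
  -- and `pr''^*` is natural
  have enat : pr''.app ⊤ (sbh.appTop b) =
      (X ⊗ specOver K Γ(↑V, ⊤)).left.presheaf.map
        ((Opens.map pr''.base).map (homOfLE (specToBase_preimage_eq_top hV).ge).op.unop).op
        (pr''.app (stb ⁻¹ᵁ V) (stb.app V x)) := by
    rw [← eres, ← CommRingCat.comp_apply, pr''.naturality, CommRingCat.comp_apply]
  -- assemble (no `rw` across `ofSection`: the three links are composed as equalities)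
  have hξV : genericPoint (X ⊗ specOver K Γ(↑V, ⊤)).left ∈ pr'' ⁻¹ᵁ (stb ⁻¹ᵁ V) := by
    rw [← hR]; exact genericPoint_mem_preimage _ 𝔚.genericPoint_mem
  have s1 : ofSection (genericPoint_mem_preimage (𝔚.stageLeg hV) (𝔚.stageCover hV).genericPoint_mem)
      ((𝔚.stageLeg hV).app ((snd X (𝔚.stageBase hV)).left ⁻¹ᵁ ⊤)
        ((snd X (𝔚.stageBase hV)).left.app ⊤ b)) = ofSection hξ'' (pr''.app ⊤ (sbh.appTop b)) :=
    (congrArg (ofSection _) eL).trans (ofSection_map _ _ _)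
  have s2 : ofSection hξ'' (pr''.app ⊤ (sbh.appTop b)) =
      ofSection hξV (pr''.app (stb ⁻¹ᵁ V) (stb.app V x)) :=
    (congrArg (ofSection hξ'') enat).trans (ofSection_map _ _ _)
  have s3 : ofSection (genericPoint_mem_preimage (toProd X T V hV) 𝔚.genericPoint_mem)
      ((toProd X T V hV).app ((snd X T).left ⁻¹ᵁ V) ((snd X T).left.app V x)) =
      ofSection hξV (pr''.app (stb ⁻¹ᵁ V) (stb.app V x)) :=
    (congrArg (ofSection _) eR).trans (ofSection_map _ _ _)
  exact s1.trans (s2.trans s3.symm)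

/-- **The pullback of rational functions `Θ` as an `f`-semilinear map** between the function
fields with their module structures over `Γ(Spec K[t], 𝒪)` and `Γ(V, 𝒪_T)`
(`CartierDivisor.baseAlgebra`), the shape consumed by
`Literature/Algebra/Homology/OrderedCechExtendScalars`. [folklore] -/
def stageΘₛₗ :
    letI := CartierDivisor.baseAlgebra (snd X (𝔚.stageBase hV)).left ⊤ (𝔚.stageCover hV).genericPoint_mem
    letI := CartierDivisor.baseAlgebra (snd X T).left V 𝔚.genericPoint_mem
    (X ⊗ 𝔚.stageBase hV).left.functionField →ₛₗ[𝔚.stageRingHom hV] (X ⊗ T).left.functionField :=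
  letI := CartierDivisor.baseAlgebra (snd X (𝔚.stageBase hV)).left ⊤ (𝔚.stageCover hV).genericPoint_mem
  letI := CartierDivisor.baseAlgebra (snd X T).left V 𝔚.genericPoint_mem
  { toFun := 𝔚.stageΘ hV
    map_add' := map_add _
    map_smul' := fun b x => by
      rw [Algebra.smul_def, Algebra.smul_def, map_mul, CartierDivisor.baseAlgebra_algebraMap,
        CartierDivisor.baseAlgebra_algebraMap, stageΘ_ofSection_app] }

/-- `stageΘₛₗ` is `Θ` on elements. [folklore] -/
@[simp] theorem stageΘₛₗ_apply (x : (X ⊗ 𝔚.stageBase hV).left.functionField) :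
    𝔚.stageΘₛₗ hV x = 𝔚.stageΘ hV x := rfl

/-! ### `Θ` maps sections of `𝒪(D₀)` to sections of `𝒪(D)` -/

/-- **`Θ(Γ(W₀_s, 𝒪(D₀))) ⊆ Γ(W_s, 𝒪(D))`** for every finite set of indices `s`: a rational function
`x` with `ψ_a x` regular on `W₀_a ∩ W₀_s` for all `a` pulls back to one with `f_{c(a)} Θ(x)`
regular on `W_a ∩ W_s` (regularity ascends along `π_t` and descends along the flat `toProd`,
`RatFn.IsRegularAt.of_functionFieldMap`), and `f_i / f_{c(a)}` is a unit on `U_i ∩ W_a`.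
[folklore] -/
theorem stageΘ_mem_sectionsOn (s : Finset (Fin (𝔚.r + 1)))
    (x : (X ⊗ 𝔚.stageBase hV).left.functionField) (hx : x ∈ (𝔚.stageCover hV).sectionsOn s) :
    𝔚.stageΘ hV x ∈ 𝔚.sectionsOn s := by
  rw [CechCover.mem_sectionsOn_iff] at hx ⊢
  intro i y hi hy
  -- `y = toProd y''`
  have hyV : y ∈ (snd X T).left ⁻¹ᵁ V := 𝔚.opens_le s hy
  have hy' : y ∈ Set.range (toProd X T V hV) := by rw [range_toProd]; exact hyV
  obtain ⟨y'', rfl⟩ := hy'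
  -- a member `W_a ∋ y` of the cover, through the stage
  obtain ⟨a, ha⟩ := 𝔚.exists_mem_stageW hV (𝔚.stageLeg hV y'')
  have hya : toProd X T V hV y'' ∈ 𝔚.W a := by
    have h1 : y'' ∈ 𝔚.stageLeg hV ⁻¹ᵁ 𝔚.stageW hV a := (Scheme.Hom.mem_preimage _).2 ha
    rw [𝔚.preimage_stageW hV] at h1
    exact (Scheme.Hom.mem_preimage _).1 h1
  -- `π_t(y'') ∈ W₀_s`
  have hy₀ : 𝔚.stageLeg hV y'' ∈ (𝔚.stageCover hV).opens s := by
    have h1 : y'' ∈ toProd X T V hV ⁻¹ᵁ 𝔚.opens s := (Scheme.Hom.mem_preimage _).2 hy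
    rw [← 𝔚.preimage_stageCover_opens hV] at h1
    exact (Scheme.Hom.mem_preimage _).1 h1
  -- `ψ_a x` is regular at `π_t(y'')`, so `f_{c(a)} Θ(x)` is regular at `y`
  have hreg₀ := hx ⟨a⟩ _ ha hy₀
  have hreg₁ : IsRegularAt y'' (functionFieldMap (toProd X T V hV)
      (𝔚.stageΘ hV (𝔚.stageψ hV a * x))) := by
    rw [functionFieldMap_toProd_stageΘ]
    exact hreg₀.functionFieldMap
  have hreg : IsRegularAt (toProd X T V hV y'') (D.f (𝔚.chart a) * 𝔚.stageΘ hV x) := by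
    have h := IsRegularAt.of_functionFieldMap (toProd X T V hV) hreg₁
    rwa [map_mul, stageΘ_stageψ] at h
  -- `f_i Θ(x) = (f_i / f_{c(a)}) (f_{c(a)} Θ(x))`
  have e : D.f i * 𝔚.stageΘ hV x = D.f i / D.f (𝔚.chart a) * (D.f (𝔚.chart a) * 𝔚.stageΘ hV x) := by
    field_simp [D.f_ne_zero (𝔚.chart a)]
  rw [e]
  exact (D.isUnitAt_div i (𝔚.chart a) _ hi (𝔚.W_le_U a hya)).isRegularAt.mul hreg

/-! ### Generic bookkeeping: `appLE` and rational functions -/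

omit [IsIntegral (X ⊗ T).left] [IsIntegral (X ⊗ specOver K Γ(↑V, ⊤)).left] [IsDomain Γ(↑V, ⊤)]
  [∀ t, IsIntegral ((prodDiagram K Γ(↑V, ⊤) (∅ : Finset Γ(↑V, ⊤)) X).obj t)] [IsProper X.hom] in
/-- `g.appLE ⊤ ⊤ _ = g.appTop`. [folklore] -/
theorem appLE_top_top {Y Z : Scheme.{u}} (g : Y ⟶ Z) (e : (⊤ : Y.Opens) ≤ g ⁻¹ᵁ ⊤) :
    g.appLE ⊤ ⊤ e = g.appTop := by
  rw [Scheme.Hom.appLE, show homOfLE e = 𝟙 _ from Subsingleton.elim _ _, op_id]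
  erw [CategoryTheory.Functor.map_id]
  rw [Category.comp_id]

omit [IsIntegral (X ⊗ T).left] [IsIntegral (X ⊗ specOver K Γ(↑V, ⊤)).left] [IsDomain Γ(↑V, ⊤)]
  [∀ t, IsIntegral ((prodDiagram K Γ(↑V, ⊤) (∅ : Finset Γ(↑V, ⊤)) X).obj t)] [IsProper X.hom] in
/-- **The rational function of `g^*(r)|_W` is `g^♯` of the rational function of `r`** (`appLE`
form of `RatFn.functionFieldMap_ofSection`). [folklore] -/
theorem ofSection_appLE {Y Z : Scheme.{u}} [IsIntegral Y] [IsIntegral Z] (g : Y ⟶ Z) [IsDominant g]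
    {U : Z.Opens} {W : Y.Opens} (hU : genericPoint Z ∈ U) (hW : genericPoint Y ∈ W) (e : W ≤ g ⁻¹ᵁ U)
    (r : Γ(Z, U)) : ofSection hW (g.appLE U W e r) = functionFieldMap g (ofSection hU r) := by
  rw [Scheme.Hom.appLE, CommRingCat.comp_apply, ofSection_map, functionFieldMap_ofSection]

/-! ### The base-change maps `Γ(V, 𝒪_T) ⊗_{K[t]} Γ(W₀_s, 𝒪(D₀)) → Γ(W_s, 𝒪(D))` are bijective -/

/-- `Θ` maps `Γ(W₀_s, 𝒪(D₀))` into `Γ(W_s, 𝒪(D))` (hypothesis `hΘ` of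
`Literature/Algebra/Homology/OrderedCechExtendScalars`, semilinear form). [folklore] -/
theorem stageΘₛₗ_mem (s : Finset (Fin (𝔚.r + 1))) (x : (X ⊗ 𝔚.stageBase hV).left.functionField)
    (hx : x ∈ (𝔚.stageCover hV).sectionsOn s) : 𝔚.stageΘₛₗ hV x ∈ 𝔚.sectionsOn s :=
  𝔚.stageΘ_mem_sectionsOn hV s x hx

omit [IsIntegral (X ⊗ T).left] [IsIntegral (X ⊗ specOver K Γ(↑V, ⊤)).left] [IsDomain Γ(↑V, ⊤)]
  [∀ t, IsIntegral ((prodDiagram K Γ(↑V, ⊤) (∅ : Finset Γ(↑V, ⊤)) X).obj t)] [IsProper X.hom] in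
/-- **The restriction `Γ(V, 𝒪_T) → Γ(Spec B, 𝒪)` followed by `pr_{Spec B}^*` is `pr_T^*` followed
by `toProd^*`** (both are `(toProd ≫ pr_T)^* = (pr_{Spec B} ≫ (Spec B → T))^*`), as maps
`Γ(V, 𝒪_T) → Γ(U, 𝒪)` for an open `U` of `(X ⊗ Spec B).left`. [folklore] -/
theorem resSpec_comp_appLE (U : (X ⊗ specOver K Γ(↑V, ⊤)).left.Opens)
    (h₁ : U ≤ (snd X (specOver K Γ(↑V, ⊤))).left ⁻¹ᵁ ⊤) (h₂ : U ≤ toProd X T V hV ⁻¹ᵁ ((snd X T).left ⁻¹ᵁ V)) :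
    resSpec T V hV ≫ (snd X (specOver K Γ(↑V, ⊤))).left.appLE ⊤ U h₁ =
      (snd X T).left.app V ≫ (toProd X T V hV).appLE ((snd X T).left ⁻¹ᵁ V) U h₂ := by
  rw [resSpec, Scheme.Hom.appLE_comp_appLE, Scheme.Hom.app_eq_appLE, Scheme.Hom.appLE_comp_appLE]
  exact appLE_congrHom (toProd_comp_snd (X := X) hV).symm V U _ _

omit [IsDomain Γ(↑V, ⊤)] [∀ t, IsIntegral ((prodDiagram K Γ(↑V, ⊤) (∅ : Finset Γ(↑V, ⊤)) X).obj t)]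
  [IsProper X.hom] in
/-- **`(toProd^♯)⁻¹` of the rational function of `pr_{Spec B}^*(c|_{Spec B})|_U` is the rational
function of `pr_T^*(c)`** (`c ∈ Γ(V, 𝒪_T)`; both are `(toProd ≫ pr_T)^* c` read in `K(X ×_K T)`).
[folklore] -/
theorem symm_ofSection_appLE_resSpec (U : (X ⊗ specOver K Γ(↑V, ⊤)).left.Opens)
    (h₁ : U ≤ (snd X (specOver K Γ(↑V, ⊤))).left ⁻¹ᵁ ⊤) (h₂ : U ≤ toProd X T V hV ⁻¹ᵁ ((snd X T).left ⁻¹ᵁ V))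
    (hξU : genericPoint (X ⊗ specOver K Γ(↑V, ⊤)).left ∈ U)
    (hξ' : genericPoint (X ⊗ T).left ∈ (snd X T).left ⁻¹ᵁ V) (c : Γ(T.left, V)) :
    (toProdFieldEquiv X T V hV).symm
        (ofSection hξU ((snd X (specOver K Γ(↑V, ⊤))).left.appLE ⊤ U h₁ (resSpec T V hV c))) =
      ofSection hξ' ((snd X T).left.app V c) := by
  have h := congrArg (fun φ : Γ(T.left, V) ⟶ _ => φ c) (resSpec_comp_appLE (X := X) hV U h₁ h₂)
  simp only [CommRingCat.comp_apply] at h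
  exact (congrArg (fun p => (toProdFieldEquiv X T V hV).symm (ofSection hξU p)) h).trans
    ((congrArg (toProdFieldEquiv X T V hV).symm
      (ofSection_appLE (toProd X T V hV) hξ' hξU h₂ _)).trans ((toProdFieldEquiv X T V hV).symm_apply_apply _))

/-- **`(toProd^♯)⁻¹` of the rational function of `π_t^*(g)|_U` is `Θ` of the rational function of
`g`** (`g` a section of `𝒪` on an open of the stage). [folklore] -/
theorem symm_ofSection_appLE_stageLeg (U : (X ⊗ specOver K Γ(↑V, ⊤)).left.Opens)
    (hξU : genericPoint (X ⊗ specOver K Γ(↑V, ⊤)).left ∈ U) {W : (X ⊗ 𝔚.stageBase hV).left.Opens}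
    (hW : genericPoint (X ⊗ 𝔚.stageBase hV).left ∈ W) (e : U ≤ 𝔚.stageLeg hV ⁻¹ᵁ W) (g : Γ((X ⊗ 𝔚.stageBase hV).left, W)) :
    (toProdFieldEquiv X T V hV).symm (ofSection hξU ((𝔚.stageLeg hV).appLE W U e g)) =
      𝔚.stageΘ hV (ofSection hW g) := by
  rw [RingEquiv.symm_apply_eq]
  exact (ofSection_appLE (𝔚.stageLeg hV) hW hξU e g).trans (𝔚.functionFieldMap_toProd_stageΘ hV _).symm

set_option maxHeartbeats 1600000 in
/-- **`Γ(V, 𝒪_T) ⊗_{K[t]} Γ(W₀_s, 𝒪(D₀)) → Γ(W_s, 𝒪(D))`, `c ⊗ x ↦ c · Θ(x)`, is bijective** for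
every non-empty set of indices `s` — the hypothesis `hbij` of
`OrderedCech.exists_finiteFree_quasiIso_of_baseChange`. Through the trivialisations
`Γ(W₀_s, 𝒪) ≅ Γ(W₀_s, 𝒪(D₀))` (by `ψ_a⁻¹`) and `Γ(W_s, 𝒪) ≅ Γ(W_s, 𝒪(D))` (by `f_{c(a)}⁻¹`,
`a ∈ s`; `Θ(ψ_a) = f_{c(a)}`) and `Γ(V, 𝒪_T) ≅ Γ(Spec B, 𝒪)`, the map becomes the canonical
`Γ(Spec B, 𝒪) ⊗_{Γ(Spec K[t], 𝒪)} Γ(W₀_s, 𝒪) → Γ(π_t⁻¹W₀_s, 𝒪) = Γ(toProd⁻¹W_s, 𝒪) ≅ Γ(W_s, 𝒪)`,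
which is bijective because `π_t⁻¹W₀_s = W₀_s ×_{Spec K[t]} Spec B` with all three affine
(Mathlib `isIso_pushoutSection_of_isAffineOpen`: "`𝓕(V) ⊗_A A' = 𝓕(u'⁻¹(V), 𝓕')` for every
open affine subscheme `V ⊆ X`", Görtz–Wedhorn II, proof of Prop. 22.90).
[cite: GortzWedhorn2023, Prop. 22.90, proof (p. 388)] -/
theorem baseChangeMap_bijective (s : Finset (Fin (𝔚.r + 1))) (hs : s.Nonempty) :
    letI := CartierDivisor.baseAlgebra (snd X (𝔚.stageBase hV)).left ⊤ (𝔚.stageCover hV).genericPoint_mem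
    letI := CartierDivisor.baseAlgebra (snd X T).left V 𝔚.genericPoint_mem
    letI := (𝔚.stageRingHom hV).toAlgebra
    Function.Bijective (Literature.Algebra.Homology.OrderedCech.baseChangeMap (𝔚.stageRingHom hV)
      (𝔚.stageΘₛₗ hV) (𝔚.stageΘₛₗ_mem hV) s) := by
  letI algR := CartierDivisor.baseAlgebra (snd X (𝔚.stageBase hV)).left ⊤ (𝔚.stageCover hV).genericPoint_mem
  letI algS := CartierDivisor.baseAlgebra (snd X T).left V 𝔚.genericPoint_mem
  letI algRS := (𝔚.stageRingHom hV).toAlgebra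
  obtain ⟨a, ha⟩ := hs
  haveI := isSeparated_snd_left X (𝔚.stageBase hV)
  -- the opens: `W₀_s` (affine), `⊤ ⊆ Spec K[t]`, `⊤ ⊆ Spec B`, and `UY = π_t⁻¹W₀_s ∩ pr⁻¹⊤`
  have hUSX : (𝔚.stageCover hV).opens s ≤ (snd X (𝔚.stageBase hV)).left ⁻¹ᵁ ⊤ :=
    (𝔚.stageCover hV).opens_le s
  have hUST : (⊤ : (specOver K Γ(↑V, ⊤)).left.Opens) ≤ (𝔚.stageBaseHom hV).left ⁻¹ᵁ ⊤ := by
    rw [Opens.map_top]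
  have H : IsPullback (𝔚.stageLeg hV) (snd X (specOver K Γ(↑V, ⊤))).left
      (snd X (𝔚.stageBase hV)).left (𝔚.stageBaseHom hV).left :=
    isPullback_whiskerLeft_left X (𝔚.stageBaseHom hV)
  have hUX : IsAffineOpen ((𝔚.stageCover hV).opens s) :=
    (𝔚.stageCover hV).isAffineOpen_opens (isAffineOpen_top _) ⟨a, ha⟩
  haveI : IsAffine (specOver K Γ(↑V, ⊤)).left := inferInstanceAs (IsAffine (Spec _))
  have HP := (isIso_pushoutSection_iff H hUST hUSX rfl).mp
    (isIso_pushoutSection_of_isAffineOpen H hUST hUSX rfl (isAffineOpen_top _) (isAffineOpen_top _) hUX)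
  -- the rings `R = Γ(Spec K[t], 𝒪)`, `A = Γ(W₀_s, 𝒪)`, `B' = Γ(Spec B, 𝒪)`, `P = Γ(UY, 𝒪)` and
  -- the pushout square as algebras
  set UY : (X ⊗ specOver K Γ(↑V, ⊤)).left.Opens :=
    𝔚.stageLeg hV ⁻¹ᵁ (𝔚.stageCover hV).opens s ⊓ (snd X (specOver K Γ(↑V, ⊤))).left ⁻¹ᵁ ⊤ with hUY
  have hUYle : UY ≤ 𝔚.stageLeg hV ⁻¹ᵁ (𝔚.stageCover hV).opens s := inf_le_left
  have hUYle' : UY ≤ (snd X (specOver K Γ(↑V, ⊤))).left ⁻¹ᵁ ⊤ := inf_le_right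
  have hUYle'' : UY ≤ toProd X T V hV ⁻¹ᵁ ((snd X T).left ⁻¹ᵁ V) := fun y _ => by
    rw [toProd_preimage_preimage_eq_top]; trivial
  have hUYleW : UY ≤ toProd X T V hV ⁻¹ᵁ 𝔚.opens s := by
    rw [← 𝔚.preimage_stageCover_opens hV]; exact inf_le_left
  letI iRA : Algebra Γ((𝔚.stageBase hV).left, ⊤) Γ((X ⊗ 𝔚.stageBase hV).left, (𝔚.stageCover hV).opens s) :=
    ((snd X (𝔚.stageBase hV)).left.appLE ⊤ ((𝔚.stageCover hV).opens s) hUSX).hom.toAlgebra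
  letI iRB : Algebra Γ((𝔚.stageBase hV).left, ⊤) Γ((specOver K Γ(↑V, ⊤)).left, ⊤) :=
    ((𝔚.stageBaseHom hV).left.appLE ⊤ ⊤ hUST).hom.toAlgebra
  letI iAP : Algebra Γ((X ⊗ 𝔚.stageBase hV).left, (𝔚.stageCover hV).opens s)
      Γ((X ⊗ specOver K Γ(↑V, ⊤)).left, UY) :=
    ((𝔚.stageLeg hV).appLE ((𝔚.stageCover hV).opens s) UY hUYle).hom.toAlgebra
  letI iBP : Algebra Γ((specOver K Γ(↑V, ⊤)).left, ⊤) Γ((X ⊗ specOver K Γ(↑V, ⊤)).left, UY) :=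
    ((snd X (specOver K Γ(↑V, ⊤))).left.appLE ⊤ UY hUYle').hom.toAlgebra
  letI iRP : Algebra Γ((𝔚.stageBase hV).left, ⊤) Γ((X ⊗ specOver K Γ(↑V, ⊤)).left, UY) :=
    (((snd X (𝔚.stageBase hV)).left.appLE ⊤ ((𝔚.stageCover hV).opens s) hUSX) ≫
      ((𝔚.stageLeg hV).appLE ((𝔚.stageCover hV).opens s) UY hUYle)).hom.toAlgebra
  haveI : IsScalarTower Γ((𝔚.stageBase hV).left, ⊤)
      Γ((X ⊗ 𝔚.stageBase hV).left, (𝔚.stageCover hV).opens s) Γ((X ⊗ specOver K Γ(↑V, ⊤)).left, UY) :=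
    IsScalarTower.of_algebraMap_eq fun r => rfl
  haveI : IsScalarTower Γ((𝔚.stageBase hV).left, ⊤)
      Γ((specOver K Γ(↑V, ⊤)).left, ⊤) Γ((X ⊗ specOver K Γ(↑V, ⊤)).left, UY) :=
    IsScalarTower.of_algebraMap_eq fun r =>
      (DFunLike.congr_fun (congrArg CommRingCat.Hom.hom HP.w) r : _)
  have hAP : Algebra.IsPushout Γ((𝔚.stageBase hV).left, ⊤)
      Γ((X ⊗ 𝔚.stageBase hV).left, (𝔚.stageCover hV).opens s)
      Γ((specOver K Γ(↑V, ⊤)).left, ⊤) Γ((X ⊗ specOver K Γ(↑V, ⊤)).left, UY) :=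
    CommRingCat.isPushout_iff_isPushout.mp HP
  have hBAP := hAP.symm
  -- the canonical isomorphism `B' ⊗_R A ≅ P`, `b ⊗ g ↦ pr^*(b) · π_t^*(g)`
  let eP := Algebra.IsPushout.equiv Γ((𝔚.stageBase hV).left, ⊤) Γ((specOver K Γ(↑V, ⊤)).left, ⊤)
    Γ((X ⊗ 𝔚.stageBase hV).left, (𝔚.stageCover hV).opens s) Γ((X ⊗ specOver K Γ(↑V, ⊤)).left, UY)
  have eP_tmul : ∀ b g, eP (b ⊗ₜ g) =
      (snd X (specOver K Γ(↑V, ⊤))).left.appLE ⊤ UY hUYle' b *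
        (𝔚.stageLeg hV).appLE ((𝔚.stageCover hV).opens s) UY hUYle g := fun b g =>
    Algebra.IsPushout.equiv_tmul _ _ _ _ b g
  -- the trivialisation `Γ(W₀_s, 𝒪) ≅ Γ(W₀_s, 𝒪(D₀))` by `ψ_a⁻¹`
  let triv₀ : Γ((X ⊗ 𝔚.stageBase hV).left, (𝔚.stageCover hV).opens s) ≃ₗ[Γ((𝔚.stageBase hV).left, ⊤)]
      (𝔚.stageCover hV).sectionsOn s :=
    CartierDivisor.sectionsOnEquiv ((𝔚.stageCover hV).genericPoint_mem_opens s)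
      (((𝔚.stageCover hV).opens_le_W ha).trans ((𝔚.stageCover hV).W_le_U a))
      (CartierDivisor.ofSection_secAlgebra_algebraMap _ ⊤ (𝔚.stageCover hV).genericPoint_mem _ hUSX
        ((𝔚.stageCover hV).genericPoint_mem_opens s)) _
  have triv₀_coe : ∀ g, ((triv₀ g : (𝔚.stageCover hV).sectionsOn s) : (X ⊗ 𝔚.stageBase hV).left.functionField) =
      ofSection ((𝔚.stageCover hV).genericPoint_mem_opens s) g * (𝔚.stageψ hV a)⁻¹ := fun g =>
    CartierDivisor.coe_sectionsOnEquiv _ _ _ _ g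
  -- `Γ(V, 𝒪_T) ≅ Γ(Spec B, 𝒪)`, linear over `R`
  let σR : Γ(T.left, V) ≃ₗ[Γ((𝔚.stageBase hV).left, ⊤)] Γ((specOver K Γ(↑V, ⊤)).left, ⊤) :=
    { (asIso (resSpec T V hV)).commRingCatIsoToRingEquiv.toAddEquiv with
      map_smul' := fun r c => by
        change resSpec T V hV (𝔚.stageRingHom hV r * c) =
          (𝔚.stageBaseHom hV).left.appLE ⊤ ⊤ hUST r * resSpec T V hV c
        rw [map_mul, resSpec_stageRingHom, appLE_top_top] }
  have σR_apply : ∀ c, σR c = resSpec T V hV c := fun c => rfl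
  -- the composite identification `ε : S ⊗_R Γ(W₀_s, 𝒪(D₀)) ≅ B' ⊗_R A`
  let ε := TensorProduct.congr σR triv₀.symm
  have ε_tmul : ∀ c m, ε (c ⊗ₜ m) = σR c ⊗ₜ triv₀.symm m := fun c m =>
    TensorProduct.congr_tmul σR triv₀.symm c m
  -- from here on the four identifications are used through their formulas only
  clear_value σR triv₀ ε eP
  -- generic points
  have hξUY : genericPoint (X ⊗ specOver K Γ(↑V, ⊤)).left ∈ UY :=
    ⟨genericPoint_mem_preimage _ ((𝔚.stageCover hV).genericPoint_mem_opens s),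
      by rw [Opens.map_top]; trivial⟩
  -- the KEY FORMULA: `baseChangeMap z = (toProd^♯)⁻¹ (eP (ε z)) · f_{c(a)}⁻¹`
  have key : ∀ z, ((Literature.Algebra.Homology.OrderedCech.baseChangeMap (𝔚.stageRingHom hV)
      (𝔚.stageΘₛₗ hV) (𝔚.stageΘₛₗ_mem hV) s z : 𝔚.sectionsOn s) : (X ⊗ T).left.functionField) =
      (toProdFieldEquiv X T V hV).symm (ofSection hξUY (eP (ε z))) * (D.f (𝔚.chart a))⁻¹ := by
    intro z
    induction z using TensorProduct.induction_on with
    | zero => simp only [map_zero, ZeroMemClass.coe_zero, zero_mul]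
    | add x y hx hy => simp only [map_add, Submodule.coe_add, hx, hy, add_mul]
    | tmul c m =>
      obtain ⟨g, hg⟩ : ∃ g, g = triv₀.symm m := ⟨_, rfl⟩
      have hm : ((m : (𝔚.stageCover hV).sectionsOn s) : (X ⊗ 𝔚.stageBase hV).left.functionField) =
          ofSection ((𝔚.stageCover hV).genericPoint_mem_opens s) g * (𝔚.stageψ hV a)⁻¹ := by
        rw [← triv₀_coe g, hg, LinearEquiv.apply_symm_apply]
      have e1 : ((Literature.Algebra.Homology.OrderedCech.baseChangeMap (𝔚.stageRingHom hV)
          (𝔚.stageΘₛₗ hV) (𝔚.stageΘₛₗ_mem hV) s (c ⊗ₜ m) : 𝔚.sectionsOn s) :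
            (X ⊗ T).left.functionField) =
          algebraMap _ _ c * 𝔚.stageΘ hV ((m : (𝔚.stageCover hV).sectionsOn s) :
            (X ⊗ 𝔚.stageBase hV).left.functionField) :=
        (Literature.Algebra.Homology.OrderedCech.coe_baseChangeMap_tmul _ _ _ s c m).trans
          (Algebra.smul_def _ _)
      have e3 : 𝔚.stageΘ hV ((m : (𝔚.stageCover hV).sectionsOn s) :
            (X ⊗ 𝔚.stageBase hV).left.functionField) =
          𝔚.stageΘ hV (ofSection ((𝔚.stageCover hV).genericPoint_mem_opens s) g) * (D.f (𝔚.chart a))⁻¹ := by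
        rw [hm, map_mul, map_inv₀, stageΘ_stageψ]
      have t1 : eP (ε (c ⊗ₜ m)) =
          (snd X (specOver K Γ(↑V, ⊤))).left.appLE ⊤ UY hUYle' (resSpec T V hV c) *
            (𝔚.stageLeg hV).appLE ((𝔚.stageCover hV).opens s) UY hUYle g := by
        rw [ε_tmul, σR_apply, eP_tmul, ← hg]
      have e4 : (toProdFieldEquiv X T V hV).symm (ofSection hξUY (eP (ε (c ⊗ₜ m)))) =
          algebraMap _ _ c * 𝔚.stageΘ hV (ofSection ((𝔚.stageCover hV).genericPoint_mem_opens s) g) :=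
        calc (toProdFieldEquiv X T V hV).symm (ofSection hξUY (eP (ε (c ⊗ₜ m))))
            = (toProdFieldEquiv X T V hV).symm (ofSection hξUY
                ((snd X (specOver K Γ(↑V, ⊤))).left.appLE ⊤ UY hUYle' (resSpec T V hV c) *
                  (𝔚.stageLeg hV).appLE ((𝔚.stageCover hV).opens s) UY hUYle g)) := by rw [t1]
          _ = (toProdFieldEquiv X T V hV).symm (ofSection hξUY
                ((snd X (specOver K Γ(↑V, ⊤))).left.appLE ⊤ UY hUYle' (resSpec T V hV c))) *
              (toProdFieldEquiv X T V hV).symm (ofSection hξUY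
                ((𝔚.stageLeg hV).appLE ((𝔚.stageCover hV).opens s) UY hUYle g)) :=
            (congrArg (toProdFieldEquiv X T V hV).symm (map_mul _ _ _)).trans (map_mul _ _ _)
          _ = algebraMap _ _ c * 𝔚.stageΘ hV (ofSection ((𝔚.stageCover hV).genericPoint_mem_opens s) g) := by
            rw [symm_ofSection_appLE_resSpec (X := X) hV UY hUYle' hUYle'' hξUY 𝔚.genericPoint_mem c,
              𝔚.symm_ofSection_appLE_stageLeg hV UY hξUY ((𝔚.stageCover hV).genericPoint_mem_opens s)
                hUYle g]
            rfl
      rw [e1, e3, e4, mul_assoc]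
  constructor
  · -- injective: `baseChangeMap z = 0` forces `eP (ε z) = 0` (its germ at the generic point
    -- vanishes), hence `z = 0`
    intro z₁ z₂ hz
    suffices h : ∀ z, Literature.Algebra.Homology.OrderedCech.baseChangeMap (𝔚.stageRingHom hV)
        (𝔚.stageΘₛₗ hV) (𝔚.stageΘₛₗ_mem hV) s z = 0 → z = 0 from
      sub_eq_zero.1 (h _ ((map_sub _ _ _).trans (sub_eq_zero.2 hz)))
    intro z hz0
    have h1 : (toProdFieldEquiv X T V hV).symm (ofSection hξUY (eP (ε z))) * (D.f (𝔚.chart a))⁻¹ = 0 := by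
      rw [← key z, hz0]; rfl
    have h2 : (toProdFieldEquiv X T V hV).symm (ofSection hξUY (eP (ε z))) = 0 :=
      (mul_eq_zero.1 h1).resolve_right (inv_ne_zero (D.f_ne_zero _))
    have h3 : ofSection hξUY (eP (ε z)) = 0 :=
      (map_eq_zero_iff _ (toProdFieldEquiv X T V hV).symm.injective).1 h2
    have h4 : eP (ε z) = 0 :=
      germ_injective_of_isIntegral _ _ hξUY (h3.trans (map_zero _).symm)
    have h5 : ε z = 0 := eP.injective (h4.trans (map_zero eP).symm)
    exact ε.injective (h5.trans (map_zero ε).symm)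
  · -- surjective: a section of `𝒪(D)` over `W_s` is `f_{c(a)}⁻¹ g` with `g ∈ Γ(W_s, 𝒪)`;
    -- transport `g` to `Γ(UY, 𝒪)` along `toProd` and pull it back through `eP` and `ε`
    intro y
    letI := CartierDivisor.secAlgebra (snd X T).left V (𝔚.opens s) (𝔚.opens_le s)
    obtain ⟨gY, hgY⟩ := CartierDivisor.trivialisation_surjective (𝔚.genericPoint_mem_opens s)
      ((𝔚.opens_le_W ha).trans (𝔚.W_le_U a))
      (CartierDivisor.ofSection_secAlgebra_algebraMap _ V 𝔚.genericPoint_mem _ (𝔚.opens_le s)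
        (𝔚.genericPoint_mem_opens s)) _ y
    obtain ⟨p, hp⟩ : ∃ p : Γ((X ⊗ specOver K Γ(↑V, ⊤)).left, UY),
        p = (toProd X T V hV).appLE (𝔚.opens s) UY hUYleW gY := ⟨_, rfl⟩
    refine ⟨ε.symm (eP.symm p), Subtype.ext ?_⟩
    have k1 : eP (ε (ε.symm (eP.symm p))) = p :=
      (congrArg eP (ε.apply_symm_apply _)).trans (eP.apply_symm_apply p)
    have k2 : (toProdFieldEquiv X T V hV).symm (ofSection hξUY p) =
        ofSection (𝔚.genericPoint_mem_opens s) gY := by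
      rw [RingEquiv.symm_apply_eq, hp]
      exact ofSection_appLE (toProd X T V hV) (𝔚.genericPoint_mem_opens s) hξUY hUYleW gY
    have k3 : ((y : 𝔚.sectionsOn s) : (X ⊗ T).left.functionField) =
        ofSection (𝔚.genericPoint_mem_opens s) gY * (D.f (𝔚.chart a))⁻¹ := by
      rw [← hgY]; rfl
    rw [k3, key, k1, k2]

end CartierDivisor.CechCover

end Literature.AlgebraicGeometry.Motives

end
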